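import Summits.KontsevichZagierPeriods.KontsevichZagierPeriods.Theorems.DefinableMovesCovTransferDefKit
import HarnessLib

/-!
# KontsevichZagierPeriods / DefinableMoves — `CovTransfer`, bookkeeping IV: the validity
# conditions of a change-of-variables template are `ℚ`-definable in the coefficients

Helper file for item stmt-KontsevichZagierPeriods-4093 (`CovTransfer`) of route
`DefinableMoves`. Fix `ℚ`-semialgebraic `σ, σ' ⊆ ℝⁿ` (the two domains), `Γ, Γ' ⊆ ℝ^(n+1)` (the
graphs of the two integrands over them) and a `ℚ`-semialgebraic family
`W ⊆ ℝ^((n ⊕ n) ⊕ q)` of candidate graphs `G_d = {(x, y) | ((x, y), d) ∈ W}`, `d ∈ ℝ^q`. Each of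
the six clauses of "`G_d` is the graph over `σ` of an injective map onto `σ'` which has, at every
point of `σ`, a derivative within `σ` (little-`o` in the sup metric, `ε`–`δ`) satisfying the
Jacobian identity `f x = f' y · |det L|`" is a first-order condition on `d` over
`(ℝ, +, ·, ≤)` with rational parameters, hence cuts out a `ℚ`-definable subset of `ℝ^q`
(`definable_clause₁` – `definable_clause₆`). The clauses are spelled out literally (no
definitions), in the shapes consumed by `Theorems/DefinableMovesCovTransfer.lean`.
Folklore (Tarski; van den Dries 1998, Ch. 1).
-/

noncomputable section

open Set FirstOrder FirstOrder.Language MvPolynomial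

namespace Summit.KontsevichZagierPeriods.DefinableMoves.CovTransferAux

open Literature.ModelTheory.ExponentialFields

variable {n q : ℕ} {σ σ' : Set (Fin n → ℝ)} {Γ Γ' : Set (Fin (n + 1) → ℝ)}
  {W : Set ((Fin n ⊕ Fin n) ⊕ Fin q → ℝ)}

/-- Clause 1 (`G_d` has a point over every `x ∈ σ`) is `ℚ`-definable in `d`. [folklore] -/
theorem definable_clause₁ (hσ : IsSemialgebraic ℚ σ) (hW : IsSemialgebraic ℚ W) :
    Set.Definable (Set.range ((↑) : ℚ → ℝ)) Language.orderedRing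
      {d : Fin q → ℝ | ∀ x : Fin n → ℝ, x ∈ σ → ∃ y : Fin n → ℝ,
      Sum.elim (Sum.elim x y) d ∈ W} := by
  have hσd := definable_of_isSemialgebraic' hσ
  have hWd := definable_of_isSemialgebraic' hW
  apply definable_forall_block (β := Fin n)
  refine definable_setOf_imp_params (definable_memTuple hσd _) ?_
  apply definable_exists_block (β := Fin n)
  exact definable_memSum hWd _ _ _

/-- Clause 2 (`G_d` is functional over `σ`) is `ℚ`-definable in `d`. [folklore] -/
theorem definable_clause₂ (hσ : IsSemialgebraic ℚ σ) (hW : IsSemialgebraic ℚ W) :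
    Set.Definable (Set.range ((↑) : ℚ → ℝ)) Language.orderedRing
      {d : Fin q → ℝ | ∀ x y y' : Fin n → ℝ, x ∈ σ → Sum.elim (Sum.elim x y) d ∈ W →
      Sum.elim (Sum.elim x y') d ∈ W → ∀ i, y i = y' i} := by
  have hσd := definable_of_isSemialgebraic' hσ
  have hWd := definable_of_isSemialgebraic' hW
  apply definable_forall_block (β := Fin n)
  apply definable_forall_block (β := Fin n)
  apply definable_forall_block (β := Fin n)
  refine definable_setOf_imp_params (definable_memTuple hσd _) ?_
  refine definable_setOf_imp_params (definable_memSum hWd _ _ _) ?_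
  refine definable_setOf_imp_params (definable_memSum hWd _ _ _) ?_
  exact definable_eqTuple _ _

/-- Clause 3 (`G_d` is injective over `σ`) is `ℚ`-definable in `d`. [folklore] -/
theorem definable_clause₃ (hσ : IsSemialgebraic ℚ σ) (hW : IsSemialgebraic ℚ W) :
    Set.Definable (Set.range ((↑) : ℚ → ℝ)) Language.orderedRing
      {d : Fin q → ℝ | ∀ x x' y : Fin n → ℝ, x ∈ σ → x' ∈ σ →
      Sum.elim (Sum.elim x y) d ∈ W → Sum.elim (Sum.elim x' y) d ∈ W → ∀ i, x i = x' i} := by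
  have hσd := definable_of_isSemialgebraic' hσ
  have hWd := definable_of_isSemialgebraic' hW
  apply definable_forall_block (β := Fin n)
  apply definable_forall_block (β := Fin n)
  apply definable_forall_block (β := Fin n)
  refine definable_setOf_imp_params (definable_memTuple hσd _) ?_
  refine definable_setOf_imp_params (definable_memTuple hσd _) ?_
  refine definable_setOf_imp_params (definable_memSum hWd _ _ _) ?_
  refine definable_setOf_imp_params (definable_memSum hWd _ _ _) ?_
  exact definable_eqTuple _ _

/-- Clause 4 (`G_d` maps `σ` into `σ'`) is `ℚ`-definable in `d`. [folklore] -/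
theorem definable_clause₄ (hσ : IsSemialgebraic ℚ σ) (hσ' : IsSemialgebraic ℚ σ')
    (hW : IsSemialgebraic ℚ W) :
    Set.Definable (Set.range ((↑) : ℚ → ℝ)) Language.orderedRing
      {d : Fin q → ℝ | ∀ x y : Fin n → ℝ, x ∈ σ → Sum.elim (Sum.elim x y) d ∈ W → y ∈ σ'} := by
  have hσd := definable_of_isSemialgebraic' hσ
  have hσ'd := definable_of_isSemialgebraic' hσ'
  have hWd := definable_of_isSemialgebraic' hW
  apply definable_forall_block (β := Fin n)
  apply definable_forall_block (β := Fin n)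
  refine definable_setOf_imp_params (definable_memTuple hσd _) ?_
  refine definable_setOf_imp_params (definable_memSum hWd _ _ _) ?_
  exact definable_memTuple hσ'd _

/-- Clause 5 (`G_d` maps `σ` onto `σ'`) is `ℚ`-definable in `d`. [folklore] -/
theorem definable_clause₅ (hσ : IsSemialgebraic ℚ σ) (hσ' : IsSemialgebraic ℚ σ')
    (hW : IsSemialgebraic ℚ W) :
    Set.Definable (Set.range ((↑) : ℚ → ℝ)) Language.orderedRing
      {d : Fin q → ℝ | ∀ y : Fin n → ℝ, y ∈ σ' → ∃ x : Fin n → ℝ, x ∈ σ ∧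
      Sum.elim (Sum.elim x y) d ∈ W} := by
  have hσd := definable_of_isSemialgebraic' hσ
  have hσ'd := definable_of_isSemialgebraic' hσ'
  have hWd := definable_of_isSemialgebraic' hW
  apply definable_forall_block (β := Fin n)
  refine definable_setOf_imp_params (definable_memTuple hσ'd _) ?_
  apply definable_exists_block (β := Fin n)
  exact definable_setOf_and_params (definable_memTuple hσd _) (definable_memSum hWd _ _ _)

/-- Clause 6 (at every point of `σ`, `G_d` has a derivative matrix `L` within `σ` — little-`o` in
the sup metric, `ε`–`δ`, squared to stay polynomial — satisfying the Jacobian identity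
`f x = f' y · |det L|`, the values `f x`, `f' y` being read off the graphs `Γ`, `Γ'`) is
`ℚ`-definable in `d`. [folklore] -/
theorem definable_clause₆ (hσ : IsSemialgebraic ℚ σ) (hΓ : IsSemialgebraic ℚ Γ)
    (hΓ' : IsSemialgebraic ℚ Γ') (hW : IsSemialgebraic ℚ W) :
    Set.Definable (Set.range ((↑) : ℚ → ℝ)) Language.orderedRing
      {d : Fin q → ℝ | ∀ x y : Fin n → ℝ, x ∈ σ → Sum.elim (Sum.elim x y) d ∈ W →
      ∃ L : Fin n × Fin n → ℝ,
        (∀ c : ℝ, 0 < c → ∃ δ : ℝ, 0 < δ ∧ ∀ x₁ y₁ : Fin n → ℝ, x₁ ∈ σ →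
          Sum.elim (Sum.elim x₁ y₁) d ∈ W → (∀ i, x₁ i - x i < δ ∧ x i - x₁ i < δ) →
            ∀ i, ∃ j, (y₁ i - y i - ∑ k, L (i, k) * (x₁ k - x k)) ^ 2 ≤
              c ^ 2 * (x₁ j - x j) ^ 2) ∧
        (∃ ab : Fin 2 → ℝ, (Fin.snoc x (ab 0) : Fin (n + 1) → ℝ) ∈ Γ ∧
          (Fin.snoc y (ab 1) : Fin (n + 1) → ℝ) ∈ Γ' ∧
          ((0 ≤ (Matrix.of fun i j => L (i, j)).det ∧
              ab 0 = ab 1 * (Matrix.of fun i j => L (i, j)).det) ∨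
            ((Matrix.of fun i j => L (i, j)).det ≤ 0 ∧
              ab 0 = -(ab 1 * (Matrix.of fun i j => L (i, j)).det))))} := by
  have hσd := definable_of_isSemialgebraic' hσ
  have hΓd := definable_of_isSemialgebraic' hΓ
  have hΓ'd := definable_of_isSemialgebraic' hΓ'
  have hWd := definable_of_isSemialgebraic' hW
  apply definable_forall_block (β := Fin n)
  apply definable_forall_block (β := Fin n)
  refine definable_setOf_imp_params (definable_memTuple hσd _) ?_
  refine definable_setOf_imp_params (definable_memSum hWd _ _ _) ?_
  apply definable_exists_block (β := Fin n × Fin n)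
  refine definable_setOf_and_params ?_ ?_
  · apply definable_forall₁
    refine definable_setOf_imp_params (definable_pos _) ?_
    apply definable_exists₁
    refine definable_setOf_and_params (definable_pos _) ?_
    apply definable_forall_block (β := Fin n)
    apply definable_forall_block (β := Fin n)
    refine definable_setOf_imp_params (definable_memTuple hσd _) ?_
    refine definable_setOf_imp_params (definable_memSum hWd _ _ _) ?_
    refine definable_setOf_imp_params (definable_box _ _ _) ?_
    exact definable_derivAtom _ _ _ _ _ _
  · apply definable_exists_block (β := Fin 2)
    refine definable_setOf_and_params (definable_memSnoc hΓd _ _) ?_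
    refine definable_setOf_and_params (definable_memSnoc hΓ'd _ _) ?_
    exact definable_jacAtom _ _ _

end Summit.KontsevichZagierPeriods.DefinableMoves.CovTransferAux

end
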